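import Summits.ResolutionOfSingularities.ResolutionOfSingularities.Theorems.PurelyInseparableDim4ResConeTwoSlotDivisibility
import HarnessLib
import HarnessLib.Audit.Tags

/-!
# Purely inseparable four-folds — TWO-SLOT DIVISIBILITY READINGS AT A GENERAL POWER: a pair ledger
# `U·G = S·x_A x_B + T·H^d` in contact form kills every low coefficient off the slot product and below `x_f^d`
# (cell `res-dim4-pi`, K2(p) lane, slice B; K24b-FRAME βC3 = K24a-β3b with `3 ↦ d`)

[OURS · counted 0 · cell `res-dim4-pi` · K2(p) lane (holder res-dim4-p-12 g3); res-dim4-p-1 g3's β3b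
`…ResConeTwoSlotDivisibility` (`d = 3`, the K24a two-slot game) VERBATIM with the cube replaced by a general power
`d` — the shape the C∞ regime needs (`d = 4`, `p = 5`: K24b-FRAME, stub βC3 of res-dim4-typ-1 g2's skeleton; bus
2026-08-29 02:24:19Z «same lemma serves K24b's βC3 at d = 4») · seat res-dim4-typ-1 g3.]  Nothing here proves
K2(p)/K2(5), `NoIsolatedTrap p p` or resolution of singularities in dimension ≥ 4 / characteristic `p` — NOT
proved.  AI kernel work, weaker than expert review.

THE READ-OFF.  INPUT: the PAIR-MERGED LEDGER in contact form `U·G̃ = S·x_A x_B + T·H̃^d`, `U(0) ≠ 0`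
(res-dim4-p-2 g4's `pair_hasse_ledger_of_born`, every `p`, `2 ≤ d < p`) and the JET SHAPE of the contact polynomial
in a Tschirnhaus frame, `H̃ = x_f·W + R`, `R ∈ 𝔪₀^M`.  OUTPUT: `coeff_n G̃ = 0` whenever `|n| < M`, `n_f < d` and
`n_A = 0 ∨ n_B = 0` — i.e. `G̃ ∈ (x_A x_B, x_f^d) + 𝔪₀^M`:
* §1 `pow_mem_span_X_pow_sup_of_jet` — `H̃^d ∈ (x_f^d) + 𝔪₀^M` (`(x_f W + R)^d − (x_f W)^d` is a multiple of `R`);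
* §2 **`coeff_eq_zero_of_pair_ledger_pow`**, **`reading_eq_zero_of_pair_ledger_pow`** (on `F̃ = x^r·G̃`) — β3b's
  `coeff_eq_zero_of_pair_ledger` / `reading_eq_zero_of_pair_ledger` are the case `d = 3`.
[cite: CossartJannsenSaito2020, Thm. 3.14] bears_on: LADDER-RESOLUTION:D157-DOOR2 (res-dim4-pi · K2(p) · slice B ·
K24b-FRAME βC3).  Supports stmt-ResolutionOfSingularities-16155 (helper).
-/

set_option linter.dupNamespace false -- mandated namespace of this single-conjunct summit

noncomputable section

namespace Summit.ResolutionOfSingularities.ResolutionOfSingularities.Theorems.PIDim4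

namespace ResCone

open MvPolynomial
open Literature.AlgebraicGeometry.Resolution

variable {K : Type} [Field K]

/-! ## 1. The power of a contact polynomial in jet shape -/

/-- **`H^d ∈ (x_f^d) + 𝔪₀^M`** for `H = x_f·W + R`, `R ∈ 𝔪₀^M`: the difference `(x_f W + R)^d − (x_f W)^d` is a
multiple of `R`. [folklore] -/
theorem pow_mem_span_X_pow_sup_of_jet {f : Fin 4} {H W R : MvPolynomial (Fin 4) K} {M : ℕ} (d : ℕ)
    (hH : H = X f * W + R) (hR : R ∈ originIdeal K ^ M) :
    H ^ d ∈ Ideal.span {(X f ^ d : MvPolynomial (Fin 4) K)} ⊔ originIdeal K ^ M := by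
  obtain ⟨Q, hQ⟩ := sub_dvd_pow_sub_pow H (X f * W) d
  have hdiff : H - X f * W = R := by rw [hH, add_sub_cancel_left]
  rw [hdiff] at hQ
  have hexp : H ^ d = X f ^ d * W ^ d + R * Q := by rw [← hQ, mul_pow]; ring
  rw [hexp]
  exact Submodule.add_mem_sup (Ideal.mul_mem_right _ _ (Ideal.mem_span_singleton_self _))
    (Ideal.mul_mem_right _ _ hR)

/-! ## 2. The read-off at a general power -/

/-- **DIVISIBILITY READINGS FROM A PAIR LEDGER IN CONTACT FORM, GENERAL POWER** (K24b-FRAME βC3 = K24a-β3b with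
`3 ↦ d`).  If `U·G = S·(x_A x_B) + T·H^d` with `U(0) ≠ 0` and the contact polynomial has the jet shape
`H = x_f·W + R`, `R ∈ 𝔪₀^M`, then every coefficient of `G` at an exponent `n` with `|n| < M`, `n_f < d` and
`n_A = 0 ∨ n_B = 0` vanishes — `G ∈ (x_A x_B, x_f^d) + 𝔪₀^M`. [OURS] [cite: CossartJannsenSaito2020, Thm. 3.14] -/
theorem coeff_eq_zero_of_pair_ledger_pow {A B f : Fin 4} {G U S T H W R : MvPolynomial (Fin 4) K} {M d : ℕ}
    (hU : constantCoeff U ≠ 0) (hledger : U * G = S * (X A * X B) + T * H ^ d) (hH : H = X f * W + R)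
    (hR : R ∈ originIdeal K ^ M) {n : Fin 4 →₀ ℕ} (hnM : n.degree < M) (hnf : n f < d)
    (hn : n A = 0 ∨ n B = 0) : coeff n G = 0 := by
  set J : Ideal (MvPolynomial (Fin 4) K) :=
    Ideal.span {(X A * X B : MvPolynomial (Fin 4) K)} ⊔ Ideal.span {(X f ^ d : MvPolynomial (Fin 4) K)} with hJ
  -- `U·G ∈ J + 𝔪₀^M`
  have hUG : U * G ∈ J ⊔ originIdeal K ^ M := by
    rw [hledger, hJ, sup_assoc]
    refine Submodule.add_mem_sup (Ideal.mul_mem_left _ _ (Ideal.mem_span_singleton_self _)) ?_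
    exact Ideal.mul_mem_left _ _ (pow_mem_span_X_pow_sup_of_jet d hH hR)
  -- hence `G ∈ J + 𝔪₀^M`; read the coefficient
  have hG := mem_sup_of_unit_mul_mem hU hUG
  obtain ⟨y, hy, z, hz, hyz⟩ := Submodule.mem_sup.mp hG
  obtain ⟨y₁, hy₁, y₂, hy₂, rfl⟩ := Submodule.mem_sup.mp hy
  rw [← hyz, coeff_add, coeff_add, coeff_eq_zero_of_mem_span_X_mul_X hy₁ (not_single_add_single_le hn),
    coeff_eq_zero_of_mem_span_X_pow hy₂ hnf, coeff_eq_zero_of_mem_originIdeal_pow hz hnM, add_zero, add_zero]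

/-- **The same, read on `F̃ = x^r·G̃`**: `coeff_{r+m} F̃ = 0` for `|m| < M`, `m_f < d`, `m_A = 0 ∨ m_B = 0` — at
`d = 4` these are the C∞ frame's readings «`G̃`-monomials of `f`-degree `≤ 3` off `(x_λ x_μ)` vanish mod `𝔪₀^M`»
(the `W = 0` input of the `u`-pinning and the near non-ledger exclusion of the window law). [OURS]
[cite: CossartJannsenSaito2020, Thm. 3.14] -/
theorem reading_eq_zero_of_pair_ledger_pow {A B f : Fin 4} {F G U S T H W R : MvPolynomial (Fin 4) K}
    {r : Fin 4 →₀ ℕ} {M d : ℕ} (hF : F = monomial r 1 * G) (hU : constantCoeff U ≠ 0)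
    (hledger : U * G = S * (X A * X B) + T * H ^ d) (hH : H = X f * W + R) (hR : R ∈ originIdeal K ^ M)
    {m : Fin 4 →₀ ℕ} (hmM : m.degree < M) (hmf : m f < d) (hm : m A = 0 ∨ m B = 0) :
    coeff (r + m) F = 0 := by
  rw [hF, coeff_monomial_mul', if_pos le_self_add, add_tsub_cancel_left, one_mul]
  exact coeff_eq_zero_of_pair_ledger_pow hU hledger hH hR hmM hmf hm


/-! ## 3. The read-off survives every origin-fixing re-framing that fixes the three letters -/

/-- An origin-fixing `K`-algebra endomorphism maps `𝔪₀^M` into `𝔪₀^M`. [folklore] -/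
theorem map_mem_originIdeal_pow_of_origin (τ : MvPolynomial (Fin 4) K →ₐ[K] MvPolynomial (Fin 4) K)
    (hτ0 : ∀ i, constantCoeff (τ (X i)) = 0) {M : ℕ} {R : MvPolynomial (Fin 4) K}
    (hR : R ∈ originIdeal K ^ M) : τ R ∈ originIdeal K ^ M := by
  have hτ : τ = aeval fun i => τ (X i) := MvPolynomial.algHom_ext fun i => by rw [aeval_X]
  rw [hτ]
  exact ApproxCoordChange.map_pow_le (g := fun i => τ (X i)) hτ0 M (Ideal.mem_map_of_mem _ hR)

/-- An origin-fixing `K`-algebra endomorphism keeps constant terms. [folklore] -/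
theorem constantCoeff_map_of_origin (τ : MvPolynomial (Fin 4) K →ₐ[K] MvPolynomial (Fin 4) K)
    (hτ0 : ∀ i, constantCoeff (τ (X i)) = 0) (P : MvPolynomial (Fin 4) K) :
    constantCoeff (τ P) = constantCoeff P := by
  have hτ : τ = aeval fun i => τ (X i) := MvPolynomial.algHom_ext fun i => by rw [aeval_X]
  rw [hτ]
  exact CoordChange.constantCoeff_aeval_of_origin _ hτ0 P

/-- **THE READ-OFF SURVIVES RE-FRAMING** (K24b-FRAME: the second Tschirnhaus `ū = u − ψ(x_λ, x_μ)` and any later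
origin-fixing frame move that fixes the slot letters `x_A, x_B` and the contact letter `x_f`): pushing the pair
ledger `U·G = S·x_A x_B + T·H^d` and the jet shape `H = x_f·W + R`, `R ∈ 𝔪₀^M`, through such a `τ` gives the same
data for `τ G` (`τ R ∈ 𝔪₀^M`, `(τ U)(0) = U(0)`), hence `coeff_n (τ G) = 0` for `|n| < M`, `n_f < d`,
`n_A = 0 ∨ n_B = 0` — no commutation of `τ` with the Hasse derivative is needed. [OURS]
[cite: CossartJannsenSaito2020, Thm. 3.14] -/
theorem coeff_map_eq_zero_of_pair_ledger_pow (τ : MvPolynomial (Fin 4) K →ₐ[K] MvPolynomial (Fin 4) K)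
    {A B f : Fin 4} (hτA : τ (X A) = X A) (hτB : τ (X B) = X B) (hτf : τ (X f) = X f)
    (hτ0 : ∀ i, constantCoeff (τ (X i)) = 0) {G U S T H W R : MvPolynomial (Fin 4) K} {M d : ℕ}
    (hU : constantCoeff U ≠ 0) (hledger : U * G = S * (X A * X B) + T * H ^ d) (hH : H = X f * W + R)
    (hR : R ∈ originIdeal K ^ M) {n : Fin 4 →₀ ℕ} (hnM : n.degree < M) (hnf : n f < d)
    (hn : n A = 0 ∨ n B = 0) : coeff n (τ G) = 0 := by
  have hledger' : τ U * τ G = τ S * (X A * X B) + τ T * τ H ^ d := by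
    have h := congrArg τ hledger
    rw [map_mul, map_add, map_mul, map_mul, map_mul, map_pow, hτA, hτB] at h
    exact h
  have hH' : τ H = X f * τ W + τ R := by rw [hH, map_add, map_mul, hτf]
  have hU' : constantCoeff (τ U) ≠ 0 := by rw [constantCoeff_map_of_origin τ hτ0]; exact hU
  exact coeff_eq_zero_of_pair_ledger_pow hU' hledger' hH' (map_mem_originIdeal_pow_of_origin τ hτ0 hR) hnM hnf hn

/-- **The same, read on `τ` of `F = x^r·G`** when `τ` also fixes the ledger monomial (`τ x_i = x_i` for every
`i ∈ supp r` — e.g. `r = x_A x_B`): `coeff_{r+m} (τ F) = 0` for `|m| < M`, `m_f < d`, `m_A = 0 ∨ m_B = 0`. [OURS]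
[cite: CossartJannsenSaito2020, Thm. 3.14] -/
theorem reading_map_eq_zero_of_pair_ledger_pow (τ : MvPolynomial (Fin 4) K →ₐ[K] MvPolynomial (Fin 4) K)
    {A B f : Fin 4} (hτA : τ (X A) = X A) (hτB : τ (X B) = X B) (hτf : τ (X f) = X f)
    (hτ0 : ∀ i, constantCoeff (τ (X i)) = 0) {F G U S T H W R : MvPolynomial (Fin 4) K}
    {r : Fin 4 →₀ ℕ} (hτr : τ (monomial r 1) = monomial r 1) {M d : ℕ} (hF : F = monomial r 1 * G)
    (hU : constantCoeff U ≠ 0) (hledger : U * G = S * (X A * X B) + T * H ^ d) (hH : H = X f * W + R)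
    (hR : R ∈ originIdeal K ^ M) {m : Fin 4 →₀ ℕ} (hmM : m.degree < M) (hmf : m f < d)
    (hm : m A = 0 ∨ m B = 0) : coeff (r + m) (τ F) = 0 := by
  rw [hF, map_mul, hτr, coeff_monomial_mul', if_pos le_self_add, add_tsub_cancel_left, one_mul]
  exact coeff_map_eq_zero_of_pair_ledger_pow τ hτA hτB hτf hτ0 hU hledger hH hR hmM hmf hm

/-- The ledger monomial `x_A x_B` is fixed by any `τ` fixing `x_A` and `x_B` (the hypothesis `hτr` of
`reading_map_eq_zero_of_pair_ledger_pow` in the C∞ regime `r = x_λ x_μ`). [folklore] -/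
theorem map_monomial_pair (τ : MvPolynomial (Fin 4) K →ₐ[K] MvPolynomial (Fin 4) K) {A B : Fin 4}
    (hτA : τ (X A) = X A) (hτB : τ (X B) = X B) :
    τ (monomial (Finsupp.single A 1 + Finsupp.single B 1) 1) =
      monomial (Finsupp.single A 1 + Finsupp.single B 1) 1 := by
  have hm : (monomial (Finsupp.single A 1 + Finsupp.single B 1) 1 : MvPolynomial (Fin 4) K) = X A * X B := by
    rw [X, X, monomial_mul, mul_one]
  rw [hm, map_mul, hτA, hτB]

end ResCone

end Summit.ResolutionOfSingularities.ResolutionOfSingularities.Theorems.PIDim4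

end
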